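import Mathlib.Analysis.Calculus.SmoothSeries
import Literature.Analysis.SpecialFunctions.MatsubaraSum
import Literature.Analysis.SpecialFunctions.SechConvolutionChain
import HarnessLib

/-!
# The fermionic Matsubara sum of the Lorentzian and of its level derivative:
# `Σ_{n≥0} e/(ωₙ² + e²) = (β/4)·tanh(βe/2)` and `Σ_{n≥0} (ωₙ² − e²)/(ωₙ² + e²)² = (β²/8)·sech²(βe/2)`

Topic `Literature/Analysis/SpecialFunctions` (companion of `MatsubaraSum.lean`).  With `ωₙ = (2n+1)π/β` (`β > 0`) the real part of the
free fermion resolvent `1/(−iωₙ + e)` is the Lorentzian `e/(ωₙ² + e²)`; its Matsubara sum is `(β/4)tanh(βe/2)` (over `n ∈ ℤ`: `(β/2)tanh(βe/2)`,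
i.e. `T·Σ_{n∈ℤ} = ½tanh(e/2T)`), and — the point of this file — the sum of its `e`-DERIVATIVES `(ωₙ² − e²)/(ωₙ² + e²)²` is the derivative of the
closed form, `(β²/8)·sech²(βe/2)`, which is exponentially small for `|e| ≫ 1/β` although the summands only decay like `1/ωₙ²` and change sign at
`ωₙ = |e|` (termwise absolute values give `≍ 1/|e|`).  This CANCELLATION ACROSS FREQUENCIES is what makes level derivatives of frequency-summed pair
kernels small away from the cutoff shell (used by the Hubbard programme's pre-caustic flatness estimate, `Summits/…/KLProgrammeC4aAntidiagonalFlatnessL1`).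

* `tsum_matsubara_lorentzian` — `Σ_{n≥0} e/(ωₙ² + e²) = (β/4)·tanh(βe/2)` for every real `e` (from `tsum_one_div_matsubara_sq_add_sq`);
* `hasDerivAt_lorentzian`, `abs_lorentzian_deriv_le` — `d/de[e/(ω²+e²)] = (ω² − e²)/(ω² + e²)²`, bounded by `1/ω²` uniformly in `e`;
* `hasDerivAt_tsum_matsubara_lorentzian` — termwise differentiation of the Matsubara sum (Mathlib `hasDerivAt_tsum`, dominating series `Σ 1/ωₙ²`);
* `tsum_matsubara_lorentzian_deriv` — `Σ_{n≥0} (ωₙ² − e²)/(ωₙ² + e²)² = (β²/8)·sech(βe/2)²`;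
* `tsum_matsubara_lorentzian_deriv_nonneg`, `tsum_matsubara_lorentzian_deriv_le` — `0 ≤ … ≤ (β²/2)·e^{−β|e|}`.
Everything is proved; no named fact. [folklore]

## Sources
G. Benfatto, A. Giuliani, V. Mastropietro, Ann. Henri Poincaré 7 (2006), §2.1 (2.2)–(2.5) (`BenfattoGiulianiMastropietro2006`);
A. L. Fetter, J. D. Walecka, *Quantum Theory of Many-Particle Systems* (1971), §25. [folklore]
-/

noncomputable section

open Real Filter
open scoped Topology

namespace Literature.Analysis.SpecialFunctions

/-! ### The Lorentzian sum -/

/-- **`Σ_{n≥0} e/(ωₙ² + e²) = (β/4)·tanh(βe/2)`** (`ωₙ = (2n+1)π/β`, `β > 0`, all real `e`; both sides vanish at `e = 0`).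
[cite: BenfattoGiulianiMastropietro2006, §2.1 (2.2)-(2.5)] -/
theorem tsum_matsubara_lorentzian {β : ℝ} (hβ : 0 < β) (e : ℝ) :
    ∑' n : ℕ, e / (((2 * n + 1) * π / β) ^ 2 + e ^ 2) = β / 4 * Real.tanh (β * e / 2) := by
  rcases eq_or_ne e 0 with rfl | he
  · simp
  · have h := tsum_one_div_matsubara_sq_add_sq hβ he
    calc ∑' n : ℕ, e / (((2 * n + 1) * π / β) ^ 2 + e ^ 2)
        = ∑' n : ℕ, e * (1 / (((2 * n + 1) * π / β) ^ 2 + e ^ 2)) := tsum_congr fun n => by rw [mul_one_div]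
      _ = e * (β * Real.tanh (β * e / 2) / (4 * e)) := by rw [tsum_mul_left, h]
      _ = β / 4 * Real.tanh (β * e / 2) := by field_simp

/-! ### The level derivative of one Lorentzian -/

/-- `d/de [e/(ω² + e²)] = (ω² − e²)/(ω² + e²)²` (`ω² + e² ≠ 0`). [cite: BenfattoGiulianiMastropietro2006, §2.1 (2.2)-(2.5)] -/
theorem hasDerivAt_lorentzian (ω : ℝ) {x : ℝ} (h : ω ^ 2 + x ^ 2 ≠ 0) :
    HasDerivAt (fun y : ℝ => y / (ω ^ 2 + y ^ 2)) ((ω ^ 2 - x ^ 2) / (ω ^ 2 + x ^ 2) ^ 2) x := by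
  have h1 : HasDerivAt (fun y : ℝ => ω ^ 2 + y ^ 2) (2 * x) x := by
    have h0 := (hasDerivAt_pow 2 x).const_add (ω ^ 2)
    refine h0.congr_deriv ?_
    norm_num
  have h2 := (hasDerivAt_id x).div h1 h
  refine h2.congr_deriv ?_
  simp only [id]
  ring

/-- `|(ω² − e²)/(ω² + e²)²| ≤ 1/ω²` uniformly in `e` (`ω ≠ 0`). [cite: BenfattoGiulianiMastropietro2006, §2.1 (2.2)-(2.5)] -/
theorem abs_lorentzian_deriv_le {ω : ℝ} (hω : ω ≠ 0) (x : ℝ) :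
    |(ω ^ 2 - x ^ 2) / (ω ^ 2 + x ^ 2) ^ 2| ≤ 1 / ω ^ 2 := by
  have hω2 : 0 < ω ^ 2 := by positivity
  have hs : 0 < ω ^ 2 + x ^ 2 := by positivity
  rw [abs_div, abs_of_pos (pow_pos hs 2), div_le_div_iff₀ (pow_pos hs 2) hω2, one_mul]
  have h1 : |ω ^ 2 - x ^ 2| ≤ ω ^ 2 + x ^ 2 := by
    rw [abs_le]; constructor <;> nlinarith [sq_nonneg x, sq_nonneg ω]
  calc |ω ^ 2 - x ^ 2| * ω ^ 2 ≤ (ω ^ 2 + x ^ 2) * (ω ^ 2 + x ^ 2) :=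
        mul_le_mul h1 (by nlinarith [sq_nonneg x]) hω2.le hs.le
    _ = (ω ^ 2 + x ^ 2) ^ 2 := by ring

/-- The Matsubara frequencies are nonzero: `(2n+1)π/β ≠ 0` (`β > 0`). [cite: BenfattoGiulianiMastropietro2006, §2.1 (2.2)-(2.5)] -/
theorem matsubaraFreq_nat_ne_zero {β : ℝ} (hβ : 0 < β) (n : ℕ) : (2 * (n : ℝ) + 1) * π / β ≠ 0 := by
  have : (0 : ℝ) < (2 * (n : ℝ) + 1) * π / β := by positivity
  exact this.ne'

/-- `Σ_{n≥0} 1/ωₙ²` converges. [cite: BenfattoGiulianiMastropietro2006, §2.1 (2.2)-(2.5)] -/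
theorem summable_one_div_matsubara_sq {β : ℝ} (hβ : 0 < β) : Summable fun n : ℕ => 1 / ((2 * (n : ℝ) + 1) * π / β) ^ 2 := by
  have h := summable_one_div_matsubara_sq_add_sq hβ 0
  refine h.congr fun n => ?_
  rw [zero_pow two_ne_zero, add_zero]

/-! ### Termwise differentiation of the Matsubara sum -/

/-- **The Matsubara sum of Lorentzians is differentiable in the level, termwise**: `d/de Σ_{n≥0} e/(ωₙ² + e²) = Σ_{n≥0} (ωₙ² − e²)/(ωₙ² + e²)²`
(dominated by `Σ 1/ωₙ²`). [cite: BenfattoGiulianiMastropietro2006, §2.1 (2.2)-(2.5)] -/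
theorem hasDerivAt_tsum_matsubara_lorentzian {β : ℝ} (hβ : 0 < β) (e : ℝ) :
    HasDerivAt (fun x : ℝ => ∑' n : ℕ, x / (((2 * n + 1) * π / β) ^ 2 + x ^ 2))
      (∑' n : ℕ, (((2 * n + 1) * π / β) ^ 2 - e ^ 2) / (((2 * n + 1) * π / β) ^ 2 + e ^ 2) ^ 2) e := by
  refine hasDerivAt_tsum (u := fun n : ℕ => 1 / ((2 * (n : ℝ) + 1) * π / β) ^ 2)
    (g := fun (n : ℕ) (x : ℝ) => x / (((2 * n + 1) * π / β) ^ 2 + x ^ 2))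
    (g' := fun (n : ℕ) (x : ℝ) => (((2 * n + 1) * π / β) ^ 2 - x ^ 2) / (((2 * n + 1) * π / β) ^ 2 + x ^ 2) ^ 2)
    (summable_one_div_matsubara_sq hβ) (fun n y => hasDerivAt_lorentzian _ ?_) (fun n y => ?_) (y₀ := 0) ?_ e
  · have : 0 < ((2 * (n : ℝ) + 1) * π / β) ^ 2 := by positivity
    positivity
  · rw [Real.norm_eq_abs]
    exact abs_lorentzian_deriv_le (matsubaraFreq_nat_ne_zero hβ n) y
  · simp

/-! ### The closed form of the derivative sum -/

/-- **`Σ_{n≥0} (ωₙ² − e²)/(ωₙ² + e²)² = (β²/8)·sech(βe/2)²`** — the Matsubara sum of the level derivatives is the derivative of `(β/4)tanh(βe/2)`.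
[cite: BenfattoGiulianiMastropietro2006, §2.1 (2.2)-(2.5)] -/
theorem tsum_matsubara_lorentzian_deriv {β : ℝ} (hβ : 0 < β) (e : ℝ) :
    ∑' n : ℕ, (((2 * n + 1) * π / β) ^ 2 - e ^ 2) / (((2 * n + 1) * π / β) ^ 2 + e ^ 2) ^ 2 = β ^ 2 / 8 * sech (β * e / 2) ^ 2 := by
  have h1 := hasDerivAt_tsum_matsubara_lorentzian hβ e
  have hfun : (fun x : ℝ => ∑' n : ℕ, x / (((2 * n + 1) * π / β) ^ 2 + x ^ 2)) = fun x => β / 4 * Real.tanh (β * x / 2) :=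
    funext (tsum_matsubara_lorentzian hβ)
  rw [hfun] at h1
  have hlin : HasDerivAt (fun x : ℝ => β * x / 2) (β / 2) e := by
    have h := ((hasDerivAt_id e).const_mul β).div_const 2
    refine (h.congr_of_eventuallyEq (Eventually.of_forall fun x => ?_)).congr_deriv (by simp)
    simp [id]
  have h2 : HasDerivAt (fun x : ℝ => β / 4 * Real.tanh (β * x / 2)) (β / 4 * (sech (β * e / 2) ^ 2 * (β / 2))) e :=
    ((hasDerivAt_tanh (β * e / 2)).comp e hlin).const_mul (β / 4)
  have h3 := h1.unique h2
  rw [h3]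
  ring

/-- `0 ≤ Σ_{n≥0} (ωₙ² − e²)/(ωₙ² + e²)²`. [cite: BenfattoGiulianiMastropietro2006, §2.1 (2.2)-(2.5)] -/
theorem tsum_matsubara_lorentzian_deriv_nonneg {β : ℝ} (hβ : 0 < β) (e : ℝ) :
    0 ≤ ∑' n : ℕ, (((2 * n + 1) * π / β) ^ 2 - e ^ 2) / (((2 * n + 1) * π / β) ^ 2 + e ^ 2) ^ 2 := by
  rw [tsum_matsubara_lorentzian_deriv hβ e]
  positivity

/-- **Exponential smallness away from zero level**: `Σ_{n≥0} (ωₙ² − e²)/(ωₙ² + e²)² ≤ (β²/2)·e^{−β|e|}` (from `sech x ≤ 2e^{−|x|}`). [cite: BenfattoGiulianiMastropietro2006, §2.1 (2.2)-(2.5)] -/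
theorem tsum_matsubara_lorentzian_deriv_le {β : ℝ} (hβ : 0 < β) (e : ℝ) :
    ∑' n : ℕ, (((2 * n + 1) * π / β) ^ 2 - e ^ 2) / (((2 * n + 1) * π / β) ^ 2 + e ^ 2) ^ 2 ≤ β ^ 2 / 2 * Real.exp (-(β * |e|)) := by
  rw [tsum_matsubara_lorentzian_deriv hβ e]
  have hs := sech_le_two_mul_exp_neg_abs (β * e / 2)
  have hs0 := (sech_pos (β * e / 2)).le
  have hsq : sech (β * e / 2) ^ 2 ≤ (2 * Real.exp (-|β * e / 2|)) ^ 2 := pow_le_pow_left₀ hs0 hs 2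
  have hexp : (2 * Real.exp (-|β * e / 2|)) ^ 2 = 4 * Real.exp (-(β * |e|)) := by
    rw [mul_pow, ← Real.exp_nat_mul, abs_div, abs_mul, abs_of_pos hβ, abs_of_pos (by norm_num : (0 : ℝ) < 2)]
    push_cast
    congr 1
    · norm_num
    · congr 1; ring
  rw [hexp] at hsq
  nlinarith [hsq, pow_pos hβ 2]

end Literature.Analysis.SpecialFunctions

end
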